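import Summits.QuantumFields.YangMills.Theorems.BalabanUVNodesN22W1RelCentredLocatedAntecedentWitness
import Summits.QuantumFields.YangMills.Theorems.BalabanUVNodesN22W1RelCentredSliceInputsL2U

/-!
# BalabanUVNodes ∕ node N22 = NE9 — THE RELATIVE-DISC CENTRED ROAD OVER THE ADMISSIBLE CLASS, MODULE J17-W: THE KERNEL CERTIFICATE OF THE LOCATED OVER-RESTRICTION OF J12-D, THE
# TRANSPORT OF A UNIFORM RECORD AT VANISHING POTENTIALS TO THE LEMMA-2-SENTENCE RECORD, AND (A6) THE JOINT LOCATED ANTECEDENT `hlaw ∧ ιL2 ∧ hWsp` OF THE KNIT J17-K INHABITED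

Cell `pub-ymgap`, HUMAN RULING D-0062 (Track A), R134 ACCELERATION re-seat `pub-ymgap-dag-n22-c` (strategy s1), generation 10, file J17-W.  THEOREMS ONLY; imports J13
`…LocatedAntecedentWitness` (the degenerate uniform records J13a ∕ J13b and through them J12-D `SliceInputsLGU`) and J17-D `…SliceInputsL2U` (the Lemma-2-sentence record; through it
node00-def-W1 W1-12b and dag-n10-c module 48 `B13Lemma2LeadingParts`) BY NAME.  `--supports` K3⁷ `SpineGivenEndpointR13SepCoPH` (stmt-QuantumFields-20544) as a helper.

WHAT.
* §1 THE KERNEL CERTIFICATE of the located finding «LOCATED-LEADING-PARTS-N22» (bus 2026-08-27, this seat): for ANY record `U : SliceInputsLGU … W …` (J12-D) — (a)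
  `norm_wilson_sub_wilson_le_of_uniform`: the Wilson remainders at two configurations of `W` AGREE TO FOURTH ORDER at the zero field, `‖𝒲(ξ;Y,A) − 𝒲(ξ′;Y,A)‖ ≤ 2c₄(Y)‖A‖⁴` on the
  ρ-ball (two uses of `U.h2` against the ONE letter `U.𝒲₃ Y`); (b) ★ `cubicPart_eq_𝒲₃_of_lemma2`: if at some `ξ ∈ W` the Wilson remainder `𝒲(ξ;Y,·)` is the real slice of a function
  analytic and bounded on a complex sup-ball beginning at third order ([II] Lemma 2 p. 11 + [I] (2.8) p. 266 — print's sentence), then ITS cubic part `cubicPart Wc` IS the record's letter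
  `U.𝒲₃ Y`; hence (c) `cubicPart_eq_cubicPart_of_lemma2`: the cubic parts at ANY TWO configurations of `W` carrying Lemma 2's sentence COINCIDE — the record forces the cubic Wilson part
  to be CONFIGURATION-FREE on the thickening, which Bałaban's `V(H₁(U_k)B′)` is not; (d) the same for the older terms: `linPart_eq_D𝒪_of_lemma2` (the zero-field differential at any
  admissible history and configuration IS `U.D𝒪 old Y`).  Tool: `eq_of_homogeneous_of_norm_sub_le_pow_succ` (two `n`-homogeneous functions `(r:ℂ)ⁿ`-scaling that agree to order
  `n + 1` near the zero field are equal — scaling `A ↦ rA`, `r ↓ 0`).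
* §2 `SliceInputsLGU.nonempty_sliceInputsL2U_of_vanishing`: a uniform record whose potentials VANISH identically (`𝒲 = 0`, `𝒪 = 0` — the degenerate data of J13) yields the
  Lemma-2-sentence record `SliceInputsL2U` at the same parameters: `Wc = Oc := 0`, `RA := ρ + 1`, `M𝒲 = M𝒪 := 0`, empty bond supports, every other field copied; the restated closures
  hold because `w′, w₀ ≥ 0` (from `U.hw′ ∕ U.hw₀` and `c₀ ≥ 0`, read off `U.h0` at ONE configuration `ξ₀ ∈ W` and ONE admissible history `old₀` — hypotheses).
* §3 A6 (standing rule №189 ∕ №193) ★ `locatedAntecedentL2U_inhabited`: module J13's theorem for the repaired record — for every window `γ` and `E₀ ≥ 0`, ONE datum family + unscaled data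
  with `𝔇.UnscaledFieldLawOn χᵘ χᶜᵘ 𝒲 𝒪 γ` AND `Nonempty (SliceInputsL2U (𝔇 k′) … univ s₀ a (1∕5) (1∕100) Mv)` at every slice of every step, both regimes (J13's degenerate family
  VERBATIM, the records by J13a ∕ J13b + §2 with `ξ₀ := 0 ∈ univ`, `old₀ := 0 ∈ AdmHist` — whence `E₀ ≥ 0`, as the knit's `hrenew` forces anyway); `zero_mem_AdmHist_of_nonneg`.

HONEST FRAMING.  §1 is elementary (triangle inequality + scaling) and CERTIFIES a defect of a record TYPE authored by this seat — nothing of Bałaban's is refuted or asserted, no landed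
theorem is false; §2–§3 are bookkeeping at DEGENERATE data (vanishing potentials), NOT Bałaban's; the joint witness does NOT cover the knit's tables ∕ numerals ∕ N18-below ∕ `hGn`
(module J14's numerals are letter-compatible: `a₅ = 1∕5`, `ρb = 1∕100` unchanged); count-neutral; N22 NOT discharged (typed 28∕28 · discharged 5∕27 UNCHANGED); one finite four-torus
programme at fixed ε — NOT infinite volume, NOT OS on ℝ⁴, NOT a mass gap, NOT Clay.  0 `sorry`, 0 `def`, standard axioms.

References (TYPES ∕ loci only): [II] = [Balaban1988RG2Cluster] Lemma 2 (1.41)–(1.43) p. 11, (1.36) p. 9, (1.38)–(1.39) p. 10, (2.3) p. 12, (2.14) p. 15, (2.22) p. 16; [I] =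
[Balaban1987RG1] §1 p. 263, (2.6)–(2.13) pp. 266–268.
-/

noncomputable section

namespace YMDAG.N22.W1

open Set Metric Matrix
open scoped BigOperators
open Literature.MathematicalPhysics.QuantumFieldTheory.Balaban1983to89
open Literature.MathematicalPhysics.QuantumFieldTheory.Balaban1983to89.TreeLengthTorus (TPt TDom tsys torusTreeLen)
open Literature.MathematicalPhysics.QuantumFieldTheory.Balaban1983to89.B13Bound143 (invTau)
open Literature.MathematicalPhysics.QuantumFieldTheory.Balaban1983to89.B13TermWalkDataOneTorus (freeKernels)
open Literature.MathematicalPhysics.QuantumFieldTheory.Balaban1983to89.B5TorusCover (UT)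
open Literature.MathematicalPhysics.QuantumFieldTheory.Balaban1983to89.Step (SFConsts)
open Literature.MathematicalPhysics.QuantumFieldTheory.Balaban1983to89.Node00.Sect2 (domSys domCount CPair Setting Residual)
open Literature.MathematicalPhysics.QuantumFieldTheory.Balaban1983to89.Node00.W1
open Literature.MathematicalPhysics.QuantumFieldTheory.Balaban1983to89.B13ExpansionOrder (BeginsAt)
open Literature.MathematicalPhysics.QuantumFieldTheory.Balaban1983to89.B13Lemma2LeadingParts
  (ofRealVec ofRealVec_zero wilsonR cubicPart olderR linPart wilson_letters older_letters)

/-! ## §1 The kernel certificate: a uniform record forces the leading parts to be configuration-free on the thickening -/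

section Certificate

variable {Λ : Type*} [Fintype Λ]

/-- **Two `n`-homogeneous functions that agree to order `n + 1` near the zero field are equal**: if `f(rA) = rⁿf(A)`, `g(rA) = rⁿg(A)` for real `r` and `‖f(A) − g(A)‖ ≤ C‖A‖ⁿ⁺¹` on a
ball `‖A‖ ≤ ρ`, `ρ > 0`, then `f = g` (scale `A ↦ rA` and let `r ↓ 0`: `‖f A − g A‖ = r⁻ⁿ‖f(rA) − g(rA)‖ ≤ C·r·‖A‖ⁿ⁺¹`).  Elementary.
[cite: Balaban1988RG2Cluster, (1.38)-(1.40) p.10 (uniqueness of the leading Taylor part; elementary)] -/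
theorem eq_of_homogeneous_of_norm_sub_le_pow_succ {f g : (Λ → ℝ) → ℂ} {ρ C : ℝ} (n : ℕ) (hρ : 0 < ρ)
    (hf : ∀ (r : ℝ) (A : Λ → ℝ), f (r • A) = (r : ℂ) ^ n * f A) (hg : ∀ (r : ℝ) (A : Λ → ℝ), g (r • A) = (r : ℂ) ^ n * g A)
    (h : ∀ A : Λ → ℝ, ‖A‖ ≤ ρ → ‖f A - g A‖ ≤ C * ‖A‖ ^ (n + 1)) : f = g := by
  funext A
  rw [← sub_eq_zero, ← norm_le_zero_iff]
  refine le_of_forall_pos_le_add fun ε hε => ?_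
  rw [zero_add]
  -- the scale `r`: small enough for `rA` to lie in the ρ-ball and for `C′·r·‖A‖ⁿ⁺¹ ≤ ε`, with `C′ := max C 0`
  set C' : ℝ := max C 0 with hC'
  have hC'0 : 0 ≤ C' := le_max_right _ _
  have hCC' : C ≤ C' := le_max_left _ _
  set r : ℝ := min (ρ / (‖A‖ + 1)) (ε / (C' * ‖A‖ ^ (n + 1) + 1)) with hr
  have hA1 : 0 < ‖A‖ + 1 := by positivity
  have hK1 : 0 < C' * ‖A‖ ^ (n + 1) + 1 := by positivity
  have hr0 : 0 < r := lt_min (div_pos hρ hA1) (div_pos hε hK1)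
  have hrρ : r * ‖A‖ ≤ ρ := by
    calc r * ‖A‖ ≤ ρ / (‖A‖ + 1) * ‖A‖ := mul_le_mul_of_nonneg_right (min_le_left _ _) (norm_nonneg _)
      _ ≤ ρ / (‖A‖ + 1) * (‖A‖ + 1) := mul_le_mul_of_nonneg_left (le_add_of_nonneg_right zero_le_one) (div_pos hρ hA1).le
      _ = ρ := div_mul_cancel₀ _ hA1.ne'
  have hrε : C' * r * ‖A‖ ^ (n + 1) ≤ ε := by
    calc C' * r * ‖A‖ ^ (n + 1) = r * (C' * ‖A‖ ^ (n + 1)) := by ring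
      _ ≤ ε / (C' * ‖A‖ ^ (n + 1) + 1) * (C' * ‖A‖ ^ (n + 1)) := mul_le_mul_of_nonneg_right (min_le_right _ _) (by positivity)
      _ ≤ ε / (C' * ‖A‖ ^ (n + 1) + 1) * (C' * ‖A‖ ^ (n + 1) + 1) :=
          mul_le_mul_of_nonneg_left (le_add_of_nonneg_right zero_le_one) (div_pos hε hK1).le
      _ = ε := div_mul_cancel₀ _ hK1.ne'
  -- the bound at the scaled field `rA`
  have hnorm : ‖r • A‖ = r * ‖A‖ := by rw [norm_smul, Real.norm_of_nonneg hr0.le]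
  have hball : ‖r • A‖ ≤ ρ := hnorm ▸ hrρ
  have hb := h (r • A) hball
  rw [hf, hg, ← mul_sub, norm_mul, norm_pow, Complex.norm_real, Real.norm_of_nonneg hr0.le, hnorm, mul_pow, pow_succ] at hb
  -- `rⁿ‖f A − g A‖ ≤ C rⁿ⁺¹ ‖A‖ⁿ⁺¹ ≤ C′ rⁿ (r ‖A‖ⁿ⁺¹)`
  have hrn : 0 < r ^ n := pow_pos hr0 n
  have hb' : r ^ n * ‖f A - g A‖ ≤ r ^ n * (C' * r * ‖A‖ ^ (n + 1)) := by
    refine hb.trans ?_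
    calc C * (r ^ n * r * ‖A‖ ^ (n + 1)) ≤ C' * (r ^ n * r * ‖A‖ ^ (n + 1)) := mul_le_mul_of_nonneg_right hCC' (by positivity)
      _ = r ^ n * (C' * r * ‖A‖ ^ (n + 1)) := by ring
  exact (le_of_mul_le_mul_left hb' hrn).trans hrε

variable {c₀ : B13.Consts} {P : Params} {𝔸 : Type*} [NormedRing 𝔸] [NormedAlgebra ℂ 𝔸] [CompleteSpace 𝔸] {M k L : ℕ} [NeZero L]
  {𝔇 : TermDatum214 c₀ P 𝔸 M k L}
  {χu χcu : (Z : (domSys P M (k + 1)).Dom) → (t : TermLabel P M k L) → ((𝔇.𝒦 Z t).Λ → ℝ) → ℝ}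
  {𝒲 : (Z : (domSys P M (k + 1)).Dom) → (t : TermLabel P M k L) → CPair P 𝔸 → TDom P.d (L * domCount P M (k + 1)) → ((𝔇.𝒦 Z t).Λ → ℝ) → ℂ}
  {𝒪 : (Z : (domSys P M (k + 1)).Dom) → (t : TermLabel P M k L) → OlderTerms P 𝔸 M k → CPair P 𝔸 → TDom P.d (L * domCount P M (k + 1)) →
    ((𝔇.𝒦 Z t).Λ → ℝ) → ℂ}
  {c : B13.Consts} {G : Type*} [GaugeGroup G] {Sg : Setting 𝔸 G} {Rz : Residual P 𝔸} {cs : SFConsts} {E₀ κE : ℝ}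
  {Z : (domSys P M (k + 1)).Dom} {t : TermLabel P M k L} {W : Set (CPair P 𝔸)} {s₀ a a₅ ρb Mv : ℝ}

namespace SliceInputsLGU

variable (U : SliceInputsLGU 𝔇 χu χcu 𝒲 𝒪 c Sg Rz cs E₀ κE Z t W s₀ a a₅ ρb Mv)

/-- **THE WILSON REMAINDERS AT TWO CONFIGURATIONS OF THE THICKENING AGREE TO FOURTH ORDER** under a uniform record (J12-D): `‖𝒲(ξ;Y,A) − 𝒲(ξ′;Y,A)‖ ≤ 2c₄(Y)‖A‖⁴` on the ρ-ball —
two uses of `U.h2` against the ONE configuration-free letter `U.𝒲₃ Y`.  The located over-restriction displayed (print: [I] (2.8) p. 266, `V(H₁(U_k)B′)` depends on the configuration).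
[cite: Balaban1987RG1, (2.6)-(2.8) p.266; Balaban1988RG2Cluster, (1.39) p.10 and Lemma 2 (1.41) p.11] -/
theorem norm_wilson_sub_wilson_le_of_uniform {ξ ξ' : CPair P 𝔸} (hξ : ξ ∈ W) (hξ' : ξ' ∈ W) {Y : TDom P.d (L * domCount P M (k + 1))} (hY : Y ∈ t.1)
    (A : (𝔇.𝒦 Z t).Λ → ℝ) (hA : ‖A‖ ≤ U.ρ) : ‖𝒲 Z t ξ Y A - 𝒲 Z t ξ' Y A‖ ≤ 2 * U.c₄ Y * ‖A‖ ^ 4 := by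
  calc ‖𝒲 Z t ξ Y A - 𝒲 Z t ξ' Y A‖ = ‖(𝒲 Z t ξ Y A - U.𝒲₃ Y A) - (𝒲 Z t ξ' Y A - U.𝒲₃ Y A)‖ := by rw [sub_sub_sub_cancel_right]
    _ ≤ ‖𝒲 Z t ξ Y A - U.𝒲₃ Y A‖ + ‖𝒲 Z t ξ' Y A - U.𝒲₃ Y A‖ := norm_sub_le _ _
    _ ≤ U.c₄ Y * ‖A‖ ^ 4 + U.c₄ Y * ‖A‖ ^ 4 := add_le_add (U.h2 ξ hξ Y hY A hA) (U.h2 ξ' hξ' Y hY A hA)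
    _ = 2 * U.c₄ Y * ‖A‖ ^ 4 := by ring

/-- **THE OLDER-TERMS INCREMENTS AT TWO CONFIGURATIONS AGREE TO SECOND ORDER** under a uniform record, every admissible history: `‖(𝒪(ξ;A) − 𝒪(ξ;0)) − (𝒪(ξ′;A) − 𝒪(ξ′;0))‖ ≤ 2c₂(Y)‖A‖²`
on the ρ-ball — two uses of `U.h5` against the ONE letter `U.D𝒪 old Y`. [cite: Balaban1988RG2Cluster, (1.36) p.9 and Lemma 2 (1.41)-(1.42) p.11; Balaban1987RG1, (2.12)-(2.13) p.268] -/
theorem norm_olderIncrement_sub_le_of_uniform {old : OlderTerms P 𝔸 M k} (hold : old ∈ AdmHist (spaceOfRecord (M := M) Sg Rz (fun _ => cs.α₀) (fun _ => cs.α₁)) E₀ κE k)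
    {ξ ξ' : CPair P 𝔸} (hξ : ξ ∈ W) (hξ' : ξ' ∈ W) {Y : TDom P.d (L * domCount P M (k + 1))} (hY : Y ∈ t.1) (A : (𝔇.𝒦 Z t).Λ → ℝ) (hA : ‖A‖ ≤ U.ρ) :
    ‖(𝒪 Z t old ξ Y A - 𝒪 Z t old ξ Y 0) - (𝒪 Z t old ξ' Y A - 𝒪 Z t old ξ' Y 0)‖ ≤ 2 * U.c₂ Y * ‖A‖ ^ 2 := by
  calc ‖(𝒪 Z t old ξ Y A - 𝒪 Z t old ξ Y 0) - (𝒪 Z t old ξ' Y A - 𝒪 Z t old ξ' Y 0)‖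
        = ‖(𝒪 Z t old ξ Y A - 𝒪 Z t old ξ Y 0 - U.D𝒪 old Y A) - (𝒪 Z t old ξ' Y A - 𝒪 Z t old ξ' Y 0 - U.D𝒪 old Y A)‖ := by rw [sub_sub_sub_cancel_right]
    _ ≤ ‖𝒪 Z t old ξ Y A - 𝒪 Z t old ξ Y 0 - U.D𝒪 old Y A‖ + ‖𝒪 Z t old ξ' Y A - 𝒪 Z t old ξ' Y 0 - U.D𝒪 old Y A‖ := norm_sub_le _ _
    _ ≤ U.c₂ Y * ‖A‖ ^ 2 + U.c₂ Y * ‖A‖ ^ 2 := add_le_add (U.h5 old hold ξ hξ Y hY A hA) (U.h5 old hold ξ' hξ' Y hY A hA)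
    _ = 2 * U.c₂ Y * ‖A‖ ^ 2 := by ring

/-- **★ UNDER LEMMA 2's SENTENCE THE CUBIC PART AT ANY CONFIGURATION IS THE RECORD's ONE LETTER**: if at `ξ ∈ W` the Wilson remainder `𝒲(ξ;Y,·)` (`Y ∈ 𝐃`) is the real slice of a
function `Wc` complex-differentiable and bounded by `Mw` on the complex sup-ball of a radius `R > ρ`, beginning at third order ([II] Lemma 2 p. 11, [I] (2.8) p. 266 — print's sentence),
then `cubicPart Wc = U.𝒲₃ Y`.  Proof: both are 3-homogeneous (`wilson_letters`, `U.h𝒲₃`) and agree to fourth order on the ρ-ball (`wilson_letters` (L2) + `U.h2`), §1's uniqueness.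
[cite: Balaban1988RG2Cluster, Lemma 2 (1.41)-(1.43) p.11 and (1.38)-(1.40) p.10; Balaban1987RG1, (2.6)-(2.8) p.266] -/
theorem cubicPart_eq_𝒲₃_of_lemma2 {ξ : CPair P 𝔸} (hξ : ξ ∈ W) {Y : TDom P.d (L * domCount P M (k + 1))} (hY : Y ∈ t.1)
    {Wc : ((𝔇.𝒦 Z t).Λ → ℂ) → ℂ} {R Mw : ℝ} (hρR : U.ρ < R) (hre : ∀ A : (𝔇.𝒦 Z t).Λ → ℝ, 𝒲 Z t ξ Y A = Wc (ofRealVec A))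
    (hWd : DifferentiableOn ℂ Wc (ball 0 R)) (hWM : ∀ z ∈ ball (0 : (𝔇.𝒦 Z t).Λ → ℂ) R, ‖Wc z‖ ≤ Mw) (hWB : BeginsAt Wc 3) :
    cubicPart Wc = U.𝒲₃ Y := by
  have hR : 0 < R := U.hρ.trans hρR
  obtain ⟨hhom, -, hrem, -, -⟩ := wilson_letters hρR hR hWd hWM hWB
  refine eq_of_homogeneous_of_norm_sub_le_pow_succ 3 U.hρ hhom (U.h𝒲₃ Y) (C := 2 * Mw / R ^ 4 + U.c₄ Y) fun A hA => ?_
  have h1 : ‖wilsonR Wc A - cubicPart Wc A‖ ≤ 2 * Mw / R ^ 4 * ‖A‖ ^ 4 := hrem A hA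
  have h2 : ‖𝒲 Z t ξ Y A - U.𝒲₃ Y A‖ ≤ U.c₄ Y * ‖A‖ ^ 4 := U.h2 ξ hξ Y hY A hA
  have hw : wilsonR Wc A = 𝒲 Z t ξ Y A := (hre A).symm
  rw [hw] at h1
  calc ‖cubicPart Wc A - U.𝒲₃ Y A‖ = ‖(𝒲 Z t ξ Y A - U.𝒲₃ Y A) - (𝒲 Z t ξ Y A - cubicPart Wc A)‖ := by rw [sub_sub_sub_cancel_left]
    _ ≤ ‖𝒲 Z t ξ Y A - U.𝒲₃ Y A‖ + ‖𝒲 Z t ξ Y A - cubicPart Wc A‖ := norm_sub_le _ _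
    _ ≤ U.c₄ Y * ‖A‖ ^ 4 + 2 * Mw / R ^ 4 * ‖A‖ ^ 4 := add_le_add h2 h1
    _ = (2 * Mw / R ^ 4 + U.c₄ Y) * ‖A‖ ^ (3 + 1) := by ring

/-- **★ HENCE THE CUBIC WILSON PARTS AT ANY TWO CONFIGURATIONS OF THE THICKENING COINCIDE** under a uniform record, as soon as both carry Lemma 2's sentence: `cubicPart Wc = cubicPart Wc′`
— the record forces the leading part to be CONFIGURATION-FREE on `W`, which Bałaban's `V(H₁(U_k)B′)` ([I] (2.6)–(2.8) p. 266: `H₁ = H_{1,k}`, `Δ₁` on the background of the configuration)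
is not.  THE LOCATED OVER-RESTRICTION OF J12-D, KERNEL-CERTIFIED (repair: module J17-D `SliceInputsL2U`). [cite: Balaban1987RG1, (2.6)-(2.8) p.266; Balaban1988RG2Cluster, Lemma 2 (1.41)-(1.43) p.11] -/
theorem cubicPart_eq_cubicPart_of_lemma2 {ξ ξ' : CPair P 𝔸} (hξ : ξ ∈ W) (hξ' : ξ' ∈ W) {Y : TDom P.d (L * domCount P M (k + 1))} (hY : Y ∈ t.1)
    {Wc Wc' : ((𝔇.𝒦 Z t).Λ → ℂ) → ℂ} {R Mw R' Mw' : ℝ} (hρR : U.ρ < R) (hρR' : U.ρ < R')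
    (hre : ∀ A : (𝔇.𝒦 Z t).Λ → ℝ, 𝒲 Z t ξ Y A = Wc (ofRealVec A)) (hre' : ∀ A : (𝔇.𝒦 Z t).Λ → ℝ, 𝒲 Z t ξ' Y A = Wc' (ofRealVec A))
    (hWd : DifferentiableOn ℂ Wc (ball 0 R)) (hWM : ∀ z ∈ ball (0 : (𝔇.𝒦 Z t).Λ → ℂ) R, ‖Wc z‖ ≤ Mw) (hWB : BeginsAt Wc 3)
    (hWd' : DifferentiableOn ℂ Wc' (ball 0 R')) (hWM' : ∀ z ∈ ball (0 : (𝔇.𝒦 Z t).Λ → ℂ) R', ‖Wc' z‖ ≤ Mw') (hWB' : BeginsAt Wc' 3) :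
    cubicPart Wc = cubicPart Wc' :=
  (U.cubicPart_eq_𝒲₃_of_lemma2 hξ hY hρR hre hWd hWM hWB).trans (U.cubicPart_eq_𝒲₃_of_lemma2 hξ' hY hρR' hre' hWd' hWM' hWB').symm

/-- **★ UNDER LEMMA 2's SENTENCE THE ZERO-FIELD DIFFERENTIAL OF THE OLDER TERMS AT ANY ADMISSIBLE HISTORY AND CONFIGURATION IS THE RECORD's ONE LETTER**: if `𝒪(old, ξ; Y, ·)` is the real
slice of `Oc` complex-differentiable and bounded by `Mo` on the complex sup-ball of a radius `R > ρ` ((1.34)–(1.36)), then `linPart Oc = U.D𝒪 old Y` — both 1-homogeneous, agreeing to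
second order (`older_letters` (L5) + `U.h5`), §1's uniqueness.  (The differential of Bałaban's `𝐕″(U(φ))`, [II] (1.41), depends on the configuration.)
[cite: Balaban1988RG2Cluster, (1.34)-(1.36) p.9 and Lemma 2 (1.41)-(1.42) p.11; Balaban1987RG1, (2.12)-(2.13) p.268] -/
theorem linPart_eq_D𝒪_of_lemma2 {old : OlderTerms P 𝔸 M k} (hold : old ∈ AdmHist (spaceOfRecord (M := M) Sg Rz (fun _ => cs.α₀) (fun _ => cs.α₁)) E₀ κE k)
    {ξ : CPair P 𝔸} (hξ : ξ ∈ W) {Y : TDom P.d (L * domCount P M (k + 1))} (hY : Y ∈ t.1)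
    {Oc : ((𝔇.𝒦 Z t).Λ → ℂ) → ℂ} {R Mo : ℝ} (hρR : U.ρ < R) (hre : ∀ A : (𝔇.𝒦 Z t).Λ → ℝ, 𝒪 Z t old ξ Y A = Oc (ofRealVec A))
    (hOd : DifferentiableOn ℂ Oc (ball 0 R)) (hOM : ∀ z ∈ ball (0 : (𝔇.𝒦 Z t).Λ → ℂ) R, ‖Oc z‖ ≤ Mo) :
    linPart Oc = U.D𝒪 old Y := by
  have hR : 0 < R := U.hρ.trans hρR
  obtain ⟨-, hhom, -, hrem, -, -⟩ := older_letters hρR hR hOd hOM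
  refine eq_of_homogeneous_of_norm_sub_le_pow_succ 1 U.hρ (fun r A => by rw [hhom, pow_one]) (fun r A => by rw [U.hD𝒪 old hold, pow_one])
    (C := 4 * Mo / R ^ 2 + U.c₂ Y) fun A hA => ?_
  have h1 : ‖olderR Oc A - olderR Oc 0 - linPart Oc A‖ ≤ 4 * Mo / R ^ 2 * ‖A‖ ^ 2 := hrem A hA
  have h2 : ‖𝒪 Z t old ξ Y A - 𝒪 Z t old ξ Y 0 - U.D𝒪 old Y A‖ ≤ U.c₂ Y * ‖A‖ ^ 2 := U.h5 old hold ξ hξ Y hY A hA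
  have hw : olderR Oc A = 𝒪 Z t old ξ Y A := (hre A).symm
  have hw0 : olderR Oc 0 = 𝒪 Z t old ξ Y 0 := by rw [hre 0]; rfl
  rw [hw, hw0] at h1
  calc ‖linPart Oc A - U.D𝒪 old Y A‖
        = ‖(𝒪 Z t old ξ Y A - 𝒪 Z t old ξ Y 0 - U.D𝒪 old Y A) - (𝒪 Z t old ξ Y A - 𝒪 Z t old ξ Y 0 - linPart Oc A)‖ := by rw [sub_sub_sub_cancel_left]
    _ ≤ ‖𝒪 Z t old ξ Y A - 𝒪 Z t old ξ Y 0 - U.D𝒪 old Y A‖ + ‖𝒪 Z t old ξ Y A - 𝒪 Z t old ξ Y 0 - linPart Oc A‖ := norm_sub_le _ _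
    _ ≤ U.c₂ Y * ‖A‖ ^ 2 + 4 * Mo / R ^ 2 * ‖A‖ ^ 2 := add_le_add h2 h1
    _ = (4 * Mo / R ^ 2 + U.c₂ Y) * ‖A‖ ^ (1 + 1) := by ring

/-! ## §2 A uniform record at vanishing potentials yields the Lemma-2-sentence record -/

/-- **TRANSPORT AT VANISHING POTENTIALS**: a uniform record `U : SliceInputsLGU … W …` (J12-D) whose Wilson remainder and older-terms potential VANISH identically at the slice (the
degenerate data of module J13) yields the Lemma-2-sentence record `SliceInputsL2U` (J17-D) at the same parameters: complex potentials `Wc = Oc := 0`, radius `RA := ρ + 1`, sup bounds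
`M𝒲 = M𝒪 := 0` (so every derived Taylor letter vanishes), empty bond supports `S := ∅`, the third-order onset by W1-12b's `beginsAt_zero_fun`, every other field copied; the restated
closures `hw′ ∕ hwc ∕ hw₀` hold since `0 ≤ w′`, `0 ≤ w₀` — read off `U.hw′ ∕ U.hw₀` with `c₀(Y) ≥ ‖𝒪(old₀, ξ₀; Y, 0)‖ ≥ 0` at ONE configuration `ξ₀ ∈ W` and ONE admissible history
`old₀` (hypotheses), `c₁ ≥ 0`, `R ≥ 0`.  DEGENERATE data; bookkeeping. [cite: Balaban1988RG2Cluster, Lemma 2 p.11 (degenerate data; bookkeeping); Balaban1987RG1, (2.8)-(2.9) p.266] -/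
theorem nonempty_sliceInputsL2U_of_vanishing (U : SliceInputsLGU 𝔇 χu χcu 𝒲 𝒪 c Sg Rz cs E₀ κE Z t W s₀ a a₅ ρb Mv) (h𝒲 : ∀ (ξ : CPair P 𝔸) (Y : TDom P.d (L * domCount P M (k + 1))) (A : (𝔇.𝒦 Z t).Λ → ℝ), 𝒲 Z t ξ Y A = 0)
    (h𝒪 : ∀ (old : OlderTerms P 𝔸 M k) (ξ : CPair P 𝔸) (Y : TDom P.d (L * domCount P M (k + 1))) (A : (𝔇.𝒦 Z t).Λ → ℝ), 𝒪 Z t old ξ Y A = 0)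
    {ξ₀ : CPair P 𝔸} (hξ₀ : ξ₀ ∈ W) {old₀ : OlderTerms P 𝔸 M k} (hold₀ : old₀ ∈ AdmHist (spaceOfRecord (M := M) Sg Rz (fun _ => cs.α₀) (fun _ => cs.α₁)) E₀ κE k) :
    Nonempty (SliceInputsL2U 𝔇 χu χcu 𝒲 𝒪 c Sg Rz cs E₀ κE Z t W s₀ a a₅ ρb Mv) := by
  -- signs read off the uniform record at (old₀, ξ₀)
  have hc₀ : ∀ Y ∈ t.1, 0 ≤ U.c₀ Y := fun Y hY => (norm_nonneg _).trans (U.h0 old₀ hold₀ ξ₀ hξ₀ Y hY)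
  have hsum : 0 ≤ ∑ Y ∈ t.1, U.R Y * (U.c₀ Y + U.c₁ Y * U.ρ) :=
    Finset.sum_nonneg fun Y hY => mul_nonneg (U.hR Y hY) (add_nonneg (hc₀ Y hY) (mul_nonneg (U.hc₁ Y hY) U.hρ.le))
  have hw'0 : 0 ≤ U.w' := (mul_nonneg (sq_nonneg _) hsum).trans U.hw'
  have hw₀0 : 0 ≤ U.w₀ := (Finset.sum_nonneg fun Y hY => mul_nonneg (U.hR Y hY) (hc₀ Y hY)).trans U.hw₀
  have hexp : ∀ Y : TDom P.d (L * domCount P M (k + 1)), 0 ≤ U.Cp * Real.exp (-U.κp * (tsys P.d (L * domCount P M (k + 1))).dj Y) := fun Y =>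
    mul_nonneg U.hCp (Real.exp_pos _).le
  refine ⟨{
    Uσ := U.Uσ, Uτ := U.Uτ, γ₂ := U.γ₂, rP := U.rP, qP := U.qP, kap := U.kap, kap' := U.kap', kap'' := U.kap'', θ := U.θ, θE := U.θE, θΓ := U.θΓ, θC := U.θC, KG := U.KG,
    KΓ := U.KΓ, KCs := U.KCs, K₀ := U.K₀, KE := U.KE, KG' := U.KG', KCs' := U.KCs', θΓ' := U.θΓ', θC' := U.θC', θE' := U.θE', a' := U.a', w' := U.w', cE := U.cE, g := U.g,
    Rb := U.Rb, κ := U.κ, a₀ := U.a₀, w₀ := U.w₀, T := U.T, α₀ := U.α₀, r₁ := U.r₁, TP := U.TP, ac := U.ac, wc := U.wc,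
    hW := U.hW, hpos := U.hpos, hhalf := U.hhalf, hUσ := U.hUσ, hUτ := U.hUτ, hUexp := U.hUexp, hUtau := U.hUtau, hr := U.hr, hr' := U.hr', hsubτ := U.hsubτ, hχ0 := U.hχ0,
    hχc0 := U.hχc0, hχm := U.hχm, hχcm := U.hχcm, h222 := U.h222, hγ₂ := U.hγ₂, hqP := U.hqP, hAhol := U.hAhol, hGhol := U.hGhol, hAd := U.hAd, hGd := U.hGd, hAs := U.hAs,
    hfibN := U.hfibN, hkap'' := U.hkap'', hk1 := U.hk1, hk2 := U.hk2, hθE := U.hθE, hθΓ := U.hθΓ, hθC := U.hθC, hKG := U.hKG, hKΓ := U.hKΓ, hKCs := U.hKCs, hK₀ := U.hK₀,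
    hKE := U.hKE, hG := U.hG, hΓ₀ := U.hΓ₀, hCs := U.hCs, hC216 := U.hC216, hCE := U.hCE, hdΓ := U.hdΓ, hdC := U.hdC, hdE := U.hdE, hKG' := U.hKG', hKCs' := U.hKCs',
    hθΓ' := U.hθΓ', hθC' := U.hθC', hθE' := U.hθE', hθEle := U.hθEle, hθΓle := U.hθΓle, hθR1le := U.hθR1le, hsmallKθ := U.hsmallKθ, hc0 := U.hc0, hc := U.hc, hαc := U.hαc,
    hg := U.hg, hΓq := U.hΓq, hsmall := U.hsmall, hPa := U.hPa, hvol := U.hvol, hχe := U.hχe, hχce := U.hχce, hαc_c := U.hαc_c, hsmall_c := U.hsmall_c, hvol_c := U.hvol_c,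
    hχ1 := U.hχ1, hκ := U.hκ, hboxR := U.hboxR, ha₀ := U.ha₀, hαc_b := U.hαc_b, hsmall_b := U.hsmall_b, hvol_b := U.hvol_b, hα₀ := U.hα₀, hαc_f := U.hαc_f,
    hsmall_f := U.hsmall_f, hr₁ := U.hr₁, hPa1 := U.hPa1, hA := U.hA, hθEle0 := U.hθEle0, hθΓle0 := U.hθΓle0, hθR1le0 := U.hθR1le0, hαc_0 := U.hαc_0, hsmall_0 := U.hsmall_0,
    hvol_0 := U.hvol_0, hRb := U.hRb, hTP := U.hTP, hMvT := U.hMvT, hMvP := U.hMvP,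
    ρ := U.ρ, hρ := U.hρ, h𝒲m := U.h𝒲m, h𝒲d := U.h𝒲d, R := U.R, hR := U.hR, hUτR := U.hUτR,
    S := fun _ => ∅, cubeOf := U.cubeOf, hS := fun _ _ _ hb => absurd hb (Finset.notMem_empty _),
    Cp := U.Cp, κp := U.κp, hCp := U.hCp, hκp := U.hκp, S₀ := U.S₀, hbox := U.hbox, hSS₀ := fun _ _ _ hb => absurd hb (Finset.notMem_empty _),
    Wc := fun _ _ _ _ _ => 0, Oc := fun _ _ _ _ _ _ => 0, RA := U.ρ + 1, hρRA := lt_add_one _, M𝒲 := fun _ => 0, M𝒪 := fun _ => 0,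
    hM𝒲 := fun _ _ => le_rfl, hM𝒪 := fun _ _ => le_rfl,
    h𝒲re := fun ξ _ Y A => h𝒲 ξ Y A,
    hWd := fun _ _ _ => differentiableOn_const (0 : ℂ),
    hWM := fun _ _ _ _ _ => by rw [norm_zero],
    hWB := fun _ _ _ => TermDatum214.beginsAt_zero_fun 3,
    hlocY𝒲 := fun ξ _ Y _ A A' _ => by rw [h𝒲, h𝒲],
    h𝒪re := fun old _ ξ _ Y A => h𝒪 old ξ Y A,
    hOd := fun _ _ _ _ _ => differentiableOn_const (0 : ℂ),
    hOM := fun _ _ _ _ _ _ _ => by rw [norm_zero],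
    hdecay := fun Y _ => by rw [zero_div, mul_zero]; exact hexp Y,
    δ := U.δ, hδ := U.hδ, h𝒪m := U.h𝒪m, h𝒪d := U.h𝒪d, hloc𝒪 := U.hloc𝒪, hOhol := U.hOhol,
    ha' := U.ha', hac := U.hac,
    hw' := by simpa only [zero_div, zero_mul, add_zero, mul_zero, Finset.sum_const_zero] using hw'0,
    hwc := by
      simp only [zero_div, mul_zero, zero_mul, add_zero, Finset.sum_const_zero, Real.exp_zero, ne_eq, OfNat.ofNat_ne_zero, not_false_eq_true, zero_pow]
      exact (Real.exp_pos _).le,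
    hw₀ := by simpa only [mul_zero, Finset.sum_const_zero] using hw₀0 }⟩

end SliceInputsLGU

end Certificate

/-! ## §3 A6: the joint located antecedent of the knit J17-K inhabited, both regimes -/

section Witness

variable (c : B13.Consts) (P : Params) (𝔸 : Type*) [NormedRing 𝔸] [NormedAlgebra ℂ 𝔸] [CompleteSpace 𝔸] (M L : ℕ) [NeZero L]

omit [CompleteSpace 𝔸] in
/-- **The zero history is admissible when the (1.18) amplitude is nonnegative**: `0 ∈ W1.AdmHist sp E₀ κ_E k` for `0 ≤ E₀` (size `‖0‖ ≤ E₀e^{−κd}`, analyticity of a constant).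
[cite: Balaban1987RG1, (1.18) p.263 and §1 p.263 (bookkeeping)] -/
theorem zero_mem_AdmHist_of_nonneg {k : ℕ} (sp : (j : ℕ) → (domSys P M j).Dom → Set (CPair P 𝔸)) {E₀ : ℝ} (hE₀ : 0 ≤ E₀) (κE : ℝ) :
    (0 : OlderTerms P 𝔸 M k) ∈ AdmHist sp E₀ κE k :=
  ⟨fun j Y ψ _ => by rw [Pi.zero_apply, Pi.zero_apply, Pi.zero_apply, norm_zero]; exact mul_nonneg hE₀ (Real.exp_pos _).le,
    fun j Y => show AnalyticOnNhd ℂ (fun _ : CPair P 𝔸 => (0 : ℂ)) (sp j Y) from analyticOnNhd_const⟩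

open Classical in
/-- **★ A6: THE KNIT J17-K's LOCATED ANTECEDENT IS INHABITED — ONE DATUM FAMILY, ONE SET OF UNSCALED DATA, THE UNSCALED-FIELD LAW, AND THE LEMMA-2-SENTENCE RECORD AT EVERY SLICE OF
EVERY STEP, BOTH REGIMES**: for every window `γ` and every `E₀ ≥ 0`, `∃ 𝔇 χᵘ χᶜᵘ 𝒲 𝒪` with `𝔇.UnscaledFieldLawOn χᵘ χᶜᵘ 𝒲 𝒪 γ` (W1-11, family level) AND
`∀ k′ Z t s₀, 0 < s₀ → Nonempty (SliceInputsL2U (𝔇 k′) (χᵘ k′) (χᶜᵘ k′) (𝒲 k′) (𝒪 k′) c Sg Rz cs E₀ κ_E Z t univ s₀ a (1∕5) (1∕100) Mv)`.  Witness = module J13's degenerate family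
VERBATIM (free kernels at every step, `uOf ≡ 0`, `r = 1`, `𝒱 ≡ 0`, label-dependent constant boxes, `𝒲 = 𝒪 := 0`; the law an identity of constants), the uniform records by J13b (`P(t) = ∅`) ∕
J13a (`1 ≤ |P(t)|`), TRANSPORTED to the Lemma-2 record by §2 with `ξ₀ := 0 ∈ univ` and `old₀ := 0 ∈ AdmHist` (`E₀ ≥ 0`; the knit's `hrenew` forces it anyway).  DEGENERATE data; nothing
of print's; the knit's tables ∕ numerals ∕ N18-below ∕ `hGn` are NOT covered (module J14's numerals keep the letters `a₅ = 1∕5`, `ρb = 1∕100`).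
[cite: Balaban1987RG1, (2.9)-(2.13) pp.266-268; Balaban1988RG2Cluster, (2.3) p.12, (2.14) p.15, (2.22) p.16 and Lemma 2 p.11 (degenerate data; bookkeeping)] -/
theorem locatedAntecedentL2U_inhabited (hκ₁ : 1 ≤ c.κ₁) (hinv : ∀ d : ℝ, 0 ≤ d → 0 < invTau c d ∧ invTau c d ≤ 1 / 2)
    {G : Type*} [GaugeGroup G] (Sg : Setting 𝔸 G) (Rz : Residual P 𝔸) (cs : SFConsts) {E₀ : ℝ} (hE₀ : 0 ≤ E₀) (κE : ℝ)
    {Mv : ℝ} (hMv : 1 < Mv) (a γ : ℝ) :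
    ∃ (𝔇 : TermData214 c P 𝔸 M L)
      (χu χcu : (k : ℕ) → (𝔇 k).UnscaledChi) (𝒲 : (k : ℕ) → (𝔇 k).UnscaledWilson) (𝒪 : (k : ℕ) → (𝔇 k).UnscaledOlder),
      𝔇.UnscaledFieldLawOn χu χcu 𝒲 𝒪 γ ∧
      ∀ (k : ℕ) (Z : (domSys P M (k + 1)).Dom) (t : TermLabel P M k L) (s₀ : ℝ), 0 < s₀ →
        Nonempty (SliceInputsL2U (𝔇 k) (χu k) (χcu k) (𝒲 k) (𝒪 k) c Sg Rz cs E₀ κE Z t Set.univ s₀ a (1 / 5) (1 / 100) Mv) := by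
  haveI hNe : ∀ i : Fin 0, NeZero ((![] : Fin 0 → ℕ) i) := fun i => i.elim0
  let z : UT (![] : Fin 0 → ℕ) := UT.ofSite (N := (![] : Fin 0 → ℕ)) fun i => i.elim0
  -- MODULE J13's DEGENERATE FAMILY, kept OPAQUE (an equation `h𝔇`): free kernels, zero reading, radius 1, LABEL-DEPENDENT constant boxes, zero potentials
  obtain ⟨𝔇, h𝔇⟩ : ∃ 𝔇 : TermData214 c P 𝔸 M L, 𝔇 = fun k =>
      { ν := 0, Nf := ![], E₃ := ℂ,
        𝒦 := fun _ _ => freeKernels c ℂ Unit Empty (fun _ => z) (fun _ => z),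
        finC₀ := fun _ _ => inferInstanceAs (Fintype Empty),
        decC₀ := fun _ _ => inferInstanceAs (DecidableEq Empty),
        uOf := fun _ _ _ => 0, r := 1,
        chiY₀ := fun _ t _ _ => if t.2 = ∅ then 1 else 0, chicP := fun _ t _ _ => if t.2 = ∅ then 1 else 0,
        𝒱 := fun _ _ _ _ _ _ _ => 0 } := ⟨_, rfl⟩
  -- THE UNSCALED DATA: the same label-dependent constant boxes (coupling-free), zero Wilson remainder, zero older-terms potential
  refine ⟨𝔇, fun k Z t _ => if t.2 = ∅ then 1 else 0, fun k Z t _ => if t.2 = ∅ then 1 else 0, fun _ _ _ _ _ _ => 0, fun _ _ _ _ _ _ _ => 0, ?_, ?_⟩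
  · -- (i) the unscaled-field law: an identity of constants at every step, slice and coupling
    intro k Z t s hs
    refine ⟨fun B => ?_, fun B => ?_, fun old φ Y B => ?_⟩
    · show (𝔇 k).chiY₀ Z t (s : ℂ) B = if t.2 = ∅ then 1 else 0
      subst h𝔇; rfl
    · show (𝔇 k).chicP Z t (s : ℂ) B = if t.2 = ∅ then 1 else 0
      subst h𝔇; rfl
    · show (𝔇 k).𝒱 Z t (s : ℂ) old φ Y B = (((s : ℝ) : ℂ) ^ 2)⁻¹ * 0 + 0
      rw [mul_zero, add_zero]; subst h𝔇; rfl
  · -- (ii) the Lemma-2-sentence record at every slice: J13b ∕ J13a's uniform record, transported by §2 at the vanishing potentials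
    intro k Z t s₀ hs₀
    have hA1 : ∀ (ψ : CPair P 𝔸) (σ : TPt P.d (domCount P M (k + 1)) → ℂ), (𝔇 k).A Z t ψ σ = 1 := by intro ψ σ; subst h𝔇; rfl
    have hG0 : ∀ (σ : TPt P.d (domCount P M (k + 1)) → ℂ) (ψ : CPair P 𝔸), ((𝔇 k).𝒦 Z t).G2 σ ((𝔇 k).uOf Z t ψ) = 0 := by intro σ ψ; subst h𝔇; rfl
    have hΓ0 : ((𝔇 k).𝒦 Z t).Γ₀ = 0 := by subst h𝔇; rfl
    have hC1 : ((𝔇 k).𝒦 Z t).C = 1 := by subst h𝔇; rfl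
    have hm : ((𝔇 k).𝒦 Z t).m = 1 := by subst h𝔇; rfl
    have hpow : ∀ x : ℝ, x ^ (𝔇 k).ν = 1 := fun x => by subst h𝔇; exact pow_zero x
    have hr1 : (𝔇 k).r = 1 := by subst h𝔇; rfl
    have hcardΛ : Fintype.card ((𝔇 k).𝒦 Z t).Λ = 1 := by subst h𝔇; exact Fintype.card_unit
    have hcardΛC : Fintype.card (((𝔇 k).𝒦 Z t).Λ ⊕ ((𝔇 k).𝒦 Z t).C₀) = 1 := by
      have h0 : Fintype.card ((𝔇 k).𝒦 Z t).C₀ = 0 := Fintype.card_eq_zero_iff.2 ⟨fun x => by subst h𝔇; exact Empty.elim x⟩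
      rw [Fintype.card_sum, hcardΛ, h0]
    have hZ : 1 ≤ (Z.1).card := Finset.card_pos.2 Z.2.1
    have hold₀ := zero_mem_AdmHist_of_nonneg P 𝔸 M (k := k) (spaceOfRecord (M := M) Sg Rz (fun _ => cs.α₀) (fun _ => cs.α₁)) hE₀ κE
    by_cases hP : t.2 = ∅
    · -- small field: boxes ≡ 1
      refine SliceInputsLGU.nonempty_sliceInputsL2U_of_vanishing (Classical.choice ?_) (fun _ _ _ => rfl) (fun _ _ _ _ => rfl) (Set.mem_univ (0 : CPair P 𝔸)) hold₀
      exact sliceInputsLGU_of_degenerate_smallField c P 𝔸 M k L hκ₁ hinv Sg Rz cs E₀ κE Z hZ t hP hs₀ hMv a (𝔇 k) _ _ _ _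
        hA1 hG0 hΓ0 hC1 hm hpow hr1 hcardΛ hcardΛC (funext fun _ => if_pos hP) (funext fun _ => if_pos hP) (fun _ _ => rfl) (fun _ _ _ => rfl)
    · -- large field: boxes ≡ 0
      have hP1 : 1 ≤ t.2.card := Finset.card_pos.2 (Finset.nonempty_iff_ne_empty.2 hP)
      refine SliceInputsLGU.nonempty_sliceInputsL2U_of_vanishing (Classical.choice ?_) (fun _ _ _ => rfl) (fun _ _ _ _ => rfl) (Set.mem_univ (0 : CPair P 𝔸)) hold₀
      exact sliceInputsLGU_of_degenerate_largeField c P 𝔸 M k L hκ₁ hinv Sg Rz cs E₀ κE Z hZ t hP1 hs₀ hMv a (𝔇 k) _ _ _ _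
        hA1 hG0 hΓ0 hC1 hm hpow hr1 hcardΛ hcardΛC (funext fun _ => if_neg hP) (funext fun _ => if_neg hP) (fun _ _ => rfl) (fun _ _ _ => rfl)

end Witness

end YMDAG.N22.W1

end
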